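import Literature.Computability.Cryptography.InfrastructureNavigation
import HarnessLib

/-!
# Checking a candidate period classically: the walk recognises the multiples of the regulator

Topic `Computability/Cryptography`; continues `InfrastructureNavigation.lean` (the walk `final` of an
abstract infrastructure `GiantStepCycle` with `η`-accurate distance evaluators). Hallgren's algorithm
verifies a candidate `R̃` for the regulator CLASSICALLY (Jozsa 2003, §10, step (c) after Thm. 6:
"check whether the obtained value is indeed (close to) a multiple of the period" — here by walking to
the candidate distance and looking for the unit ideal, as in Buchmann–Williams key exchange,
Jacobson–Williams §14.2). With errors in the distances the test must be tolerant, and since a single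
gap of the cycle may be tiny (only DOUBLE gaps are `≥ L`, `GiantStepCycle.two_gap`), it inspects the
walk to `x − Δ` and its first two baby steps. Theorem-and-definition file, no named facts.

* `trackBabyStep` — the explicit ideal behind a baby step (`lab (m+1)`, error `+η`);
* `CheckAt C x Δ s₀ T B j` — the `j`-th ideal after the walk to `x − Δ` is the unit ideal and its
  computed distance is within `2Δ` of `x`; **`Passes`** — some `j ≤ 2` checks;
* **`passes_sound`** — if the candidate passes then `|x − lR| ≤ 2Δ + E + 2η` for an integer `l`,
  and `l ≥ 1` when `x > 2Δ + E + 2η` (`E = Edesc + Bη` the walk's distance error);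
* **`passes_complete`** — if `|x − lR| ≤ δ` then the candidate passes, provided
  `δ + E + 2η < Δ ≤ x` and `Δ + E + η + δ < L` (the walk's adequacy hypotheses as in
  `lt_final_babyStep`).

## References

* R. Jozsa, arXiv:quant-ph/0302134 (2003), §9 Thm. 5, §10 (step (c) after Thm. 6). [Jozsa2003]
* M. J. Jacobson, Jr., H. C. Williams, *Solving the Pell Equation*, Springer (2009), §7.4, §14.2.
  [JacobsonWilliams2008]
-/

noncomputable section

open scoped Classical

namespace Literature.Computability.Cryptography

namespace GiantStepCycle

open WalkData

variable {ι : Type*} (C : GiantStepCycle ι)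

/-! ### Tracking the ideal through baby steps -/

/-- **The ideal behind a baby step**, explicitly: from `lab m` at computed distance within `E` of
`P m`, one baby step reaches `lab (m + 1)` within `E + η` of `P (m + 1)`. [cite: Jozsa2003, §9 (δ(I, ρI) = ln γ)] -/
theorem trackBabyStep {s : St ι} {m : ℤ} {E : ℝ} (hl : C.lab m = s.1) (hd : |(s.2 : ℝ) - C.P m| ≤ E) :
    C.lab (m + 1) = (C.babyStep s).1 ∧ |((C.babyStep s).2 : ℝ) - C.P (m + 1)| ≤ E + C.η := by
  refine ⟨by rw [← C.rho_lab, hl]; rfl, ?_⟩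
  have hg := C.ghat_spec m
  rw [hl] at hg
  simp only [babyStep, Rat.cast_add]
  rw [abs_le] at hd hg ⊢
  constructor <;> linarith [hd.1, hd.2, hg.1, hg.2]

/-- Iterated tracking: `j` baby steps reach `lab (m + j)` within `E + jη`. [cite: Jozsa2003, §9] -/
theorem trackIterate {s : St ι} {m : ℤ} {E : ℝ} (hl : C.lab m = s.1) (hd : |(s.2 : ℝ) - C.P m| ≤ E) (j : ℕ) :
    C.lab (m + j) = ((C.babyStep)^[j] s).1 ∧ |(((C.babyStep)^[j] s).2 : ℝ) - C.P (m + j)| ≤ E + j * C.η := by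
  induction j with
  | zero => simpa using ⟨hl, hd⟩
  | succ j ih =>
    obtain ⟨hl', hd'⟩ := ih
    have h := C.trackBabyStep hl' hd'
    rw [Function.iterate_succ_apply']
    refine ⟨by rw [← h.1]; push_cast; ring_nf, ?_⟩
    have : C.P (m + ((j + 1 : ℕ) : ℤ)) = C.P (m + j + 1) := by push_cast; ring_nf
    rw [this]
    calc _ ≤ E + j * C.η + C.η := h.2
      _ = E + ((j + 1 : ℕ) : ℝ) * C.η := by push_cast; ring

/-- The regulator is positive. [folklore] -/
theorem R_pos : 0 < C.R := by
  have h := C.periodic 0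
  have hn : (0 : ℤ) < C.n := by exact_mod_cast C.n_pos
  have := C.strictMono hn
  rw [zero_add] at h
  linarith

/-- Unit-ideal indices: `lab m = unit` iff `m` is a multiple of `n`, and then `P m = (m/n) R`. [folklore] -/
theorem exists_P_eq_of_lab_eq_unit {m : ℤ} (h : C.lab m = C.unit) : ∃ l : ℤ, C.P m = l * C.R := by
  rw [← C.lab_zero] at h
  obtain ⟨l, hl⟩ := C.exists_eq_add_mul_of_lab_eq h
  refine ⟨l, ?_⟩
  rw [hl, C.P_add_mul, C.P_zero, zero_add]

/-- Multiples of `n` are unit-ideal indices at distance `lR`. [folklore] -/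
theorem lab_mul_n (l : ℤ) : C.lab (l * C.n) = C.unit ∧ C.P (l * C.n) = l * C.R := by
  have h1 := C.lab_add_mul 0 l
  have h2 := C.P_add_mul 0 l
  rw [zero_add] at h1 h2
  rw [C.lab_zero] at h1
  rw [C.P_zero, zero_add] at h2
  exact ⟨h1, h2⟩

/-! ### The check -/

/-- The state inspected at shift `j`: `j` baby steps after the walk to `x − Δ`. [cite: Jozsa2003, §10 (c)] -/
def probe (x Δ : ℚ) (s₀ T B j : ℕ) : St ι := (C.babyStep)^[j] (C.final (x - Δ) s₀ T B)

/-- **The check at shift `j`**: the probed ideal is the unit ideal and its computed distance is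
within `2Δ` of `x`. [cite: Jozsa2003, §10 (c)] [cite: JacobsonWilliams2008, §14.2] -/
def CheckAt (x Δ : ℚ) (s₀ T B j : ℕ) : Prop :=
  (C.probe x Δ s₀ T B j).1 = C.unit ∧ |(C.probe x Δ s₀ T B j).2 - x| ≤ 2 * Δ

/-- **The candidate `x` passes** when some shift `j ≤ 2` checks. [cite: Jozsa2003, §10 (c)] -/
def Passes (x Δ : ℚ) (s₀ T B : ℕ) : Prop := ∃ j ≤ 2, C.CheckAt x Δ s₀ T B j

/-- The walk's distance error after the final rounds. [folklore] -/
def Efin (s₀ T B : ℕ) : ℝ := C.Edesc s₀ T 0 + B * C.η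

/-- `Efin ≥ 0`. [folklore] -/
theorem Efin_nonneg (s₀ T B : ℕ) : 0 ≤ C.Efin s₀ T B := by
  unfold Efin
  have := C.Edesc_nonneg s₀ T 0
  have := C.η_nonneg
  positivity

/-! ### Soundness -/

/-- **Soundness of the check**: a passing candidate is within `2Δ + E + 2η` of an integer multiple
`lR` of the regulator; and `l ≥ 1` as soon as `x > 2Δ + E + 2η`.
[cite: Jozsa2003, §10 (c)] [cite: JacobsonWilliams2008, §7.4 (𝔞₁ = (1) at the distances 0, R, 2R, …)] -/
theorem passes_sound {x Δ : ℚ} {s₀ T B : ℕ} (h : C.Passes x Δ s₀ T B) :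
    ∃ l : ℤ, |(x : ℝ) - l * C.R| ≤ 2 * Δ + C.Efin s₀ T B + 2 * C.η ∧
      ((2 : ℝ) * Δ + C.Efin s₀ T B + 2 * C.η < x → 1 ≤ l) := by
  obtain ⟨j, hj, hlab, hpos⟩ := h
  obtain ⟨m, hm, hd⟩ := C.approx_final (x - Δ) s₀ T B
  obtain ⟨hl', hd'⟩ := C.trackIterate hm hd j
  have hunit : C.lab (m + j) = C.unit := by rw [hl']; exact hlab
  obtain ⟨l, hPl⟩ := C.exists_P_eq_of_lab_eq_unit hunit
  have hposR : |(((C.probe x Δ s₀ T B j).2 : ℚ) : ℝ) - x| ≤ 2 * Δ := by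
    have : |((C.probe x Δ s₀ T B j).2 : ℚ) - x| ≤ 2 * Δ := hpos
    exact_mod_cast this
  have hjη : (j : ℝ) * C.η ≤ 2 * C.η := by
    have := C.η_nonneg
    have : (j : ℝ) ≤ 2 := by exact_mod_cast hj
    nlinarith
  have key : |(x : ℝ) - l * C.R| ≤ 2 * Δ + C.Efin s₀ T B + 2 * C.η := by
    rw [← hPl]
    have h1 := hd'
    unfold probe at hposR
    rw [abs_le] at h1 hposR ⊢
    unfold Efin
    constructor <;> linarith [h1.1, h1.2, hposR.1, hposR.2]
  refine ⟨l, key, fun hx => ?_⟩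
  by_contra hl
  push Not at hl
  have hl0 : (l : ℝ) ≤ 0 := by exact_mod_cast (show l ≤ 0 by omega)
  have hR := C.R_pos
  have : (l : ℝ) * C.R ≤ 0 := mul_nonpos_of_nonpos_of_nonneg hl0 hR.le
  rw [abs_le] at key
  linarith [key.2]

/-! ### Completeness -/

/-- **Locating the walk to `x − Δ`**: its ideal `m` has `P m ≤ x − Δ + E` and
`x − Δ < P (m + 1) + E + η` (from `final_le`, `lt_final_babyStep` and the evaluator accuracy).
[cite: Jozsa2003, §9 (proof of Thm. 5)] -/
theorem locate_final {y : ℚ} (hy : 0 ≤ y) (s₀ : ℕ) {T M : ℕ} (hyT : (y : ℝ) ≤ (C.dbl s₀ T).2)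
    (hM : C.Res s₀ T < M * (C.L - 2 * C.η)) :
    ∃ m : ℤ, C.lab m = (C.final y s₀ T (2 * M)).1 ∧
      |((C.final y s₀ T (2 * M)).2 : ℝ) - C.P m| ≤ C.Efin s₀ T (2 * M) ∧
        C.P m ≤ y + C.Efin s₀ T (2 * M) ∧ (y : ℝ) < C.P (m + 1) + C.Efin s₀ T (2 * M) + C.η := by
  obtain ⟨m, hm, hd⟩ := C.approx_final y s₀ T (2 * M)
  have hdE : |((C.final y s₀ T (2 * M)).2 : ℝ) - C.P m| ≤ C.Efin s₀ T (2 * M) := by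
    unfold Efin; exact_mod_cast hd
  refine ⟨m, hm, hdE, ?_, ?_⟩
  · have h1 : (((C.final y s₀ T (2 * M)).2 : ℚ) : ℝ) ≤ y := by exact_mod_cast C.final_le hy s₀ T (2 * M)
    rw [abs_le] at hdE
    linarith [hdE.1]
  · have h2 : ((y : ℚ) : ℝ) < (((C.babyStep (C.final y s₀ T (2 * M))).2 : ℚ) : ℝ) := by
      exact_mod_cast C.lt_final_babyStep hy s₀ hyT hM
    obtain ⟨-, hd'⟩ := C.trackBabyStep hm hdE
    rw [abs_le] at hd'
    linarith [hd'.2]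

/-- **Completeness of the check**: if `x` is within `δ` of a multiple `lR` of the regulator then it
passes, provided the tolerances are nested (`δ + E + 2η < Δ ≤ x`, `Δ + E + η + δ < L`) and the walk
to `x − Δ` is adequate. [cite: Jozsa2003, §10 (c)] [cite: JacobsonWilliams2008, §14.2] -/
theorem passes_complete {x Δ : ℚ} {δ : ℝ} (s₀ : ℕ) {T M : ℕ} {l : ℤ}
    (hΔx : Δ ≤ x) (hxT : ((x - Δ : ℚ) : ℝ) ≤ (C.dbl s₀ T).2) (hM : C.Res s₀ T < M * (C.L - 2 * C.η))
    (hclose : |(x : ℝ) - l * C.R| ≤ δ)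
    (hΔ : δ + C.Efin s₀ T (2 * M) + 2 * C.η < Δ) (hL : (Δ : ℝ) + C.Efin s₀ T (2 * M) + C.η + δ < C.L) :
    C.Passes x Δ s₀ T (2 * M) := by
  have hy : 0 ≤ x - Δ := by linarith
  obtain ⟨m, hm, hd, hP1, hP2⟩ := C.locate_final hy s₀ hxT hM
  set E := C.Efin s₀ T (2 * M) with hE
  obtain ⟨hunit, hPl⟩ := C.lab_mul_n l
  have hη := C.η_nonneg
  have hδ : 0 ≤ δ := (abs_nonneg _).trans hclose
  rw [abs_le] at hclose
  have hxΔ : ((x - Δ : ℚ) : ℝ) = (x : ℝ) - Δ := by push_cast; ring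
  rw [hxΔ] at hP1 hP2
  -- `m < l n ≤ m + 2`
  have hlt : m < l * C.n := by
    by_contra hge
    push Not at hge
    have := C.strictMono.monotone hge
    rw [hPl] at this
    linarith
  have hle : l * C.n ≤ m + 2 := by
    by_contra hgt
    push Not at hgt
    have h3 : m + 3 ≤ l * C.n := by omega
    have hmono := C.strictMono.monotone h3
    have hgap := C.two_gap (m + 1)
    rw [show m + 1 + 2 = m + 3 by ring] at hgap
    rw [hPl] at hmono
    linarith
  -- the shift `j = l n − m ∈ {1, 2}`
  obtain ⟨j, hj, hjeq⟩ : ∃ j : ℕ, j ≤ 2 ∧ (l * C.n : ℤ) = m + j :=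
    ⟨(l * C.n - m).toNat, by omega, by omega⟩
  refine ⟨j, hj, ?_, ?_⟩
  · obtain ⟨hl', -⟩ := C.trackIterate hm hd j
    unfold probe
    rw [← hl', ← hjeq, hunit]
  · obtain ⟨-, hd'⟩ := C.trackIterate hm hd j
    rw [← hjeq, hPl] at hd'
    have hjη : (j : ℝ) * C.η ≤ 2 * C.η := by
      have : (j : ℝ) ≤ 2 := by exact_mod_cast hj
      nlinarith
    have : |(((C.probe x Δ s₀ T (2 * M) j).2 : ℚ) : ℝ) - x| ≤ 2 * Δ := by
      unfold probe
      rw [abs_le] at hd' ⊢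
      constructor <;> linarith [hd'.1, hd'.2]
    have h' : |(((C.probe x Δ s₀ T (2 * M) j).2 - x : ℚ) : ℝ)| ≤ ((2 * Δ : ℚ) : ℝ) := by push_cast; exact this
    exact_mod_cast h'

end GiantStepCycle

end Literature.Computability.Cryptography

end
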